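import Literature.NumberTheory.LFunctions.NoRealZeroCertificateReplay
import HarnessLib

/-!
# Kernel replay of the Lu–Zaman–Zhao certificates: a streamlined kernel checker and row lists

Topic `Literature/NumberTheory/LFunctions`. Two additions to the kernel (`decide +kernel`) side of the
replay of Lu–Zaman–Zhao's Table-1 certificates (arXiv:2602.03626, §2.1–§3; checker and soundness in
`NoRealZeroCertificateReplay.lean`), for the HEAVY rows (certificates needing primes beyond `2^15`,
replayed against longer verified tables):

* a STREAMLINED but extensionally equal search: `pick2` (Boolean tests `Nat.beq` / `cond` instead of
  decidable propositions), `rowSearch2` (the scaled right-hand side as a natural number, the stop test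
  by `Nat.ble`), `rowOK2`, `dOK2`, `walk2`, `checkRange2` with `pick2_eq`, `rowSearch2_eq`,
  `rowOK2_eq`, `dOK2_eq`, `walk2_eq` and **`certifiedRange_of_checkRange2`** — the same meaning
  (`CertifiedRange (1/5) Q₀ Q₁ X`) at about 30 % fewer kernel reduction steps per prime term
  (measured on the farm, 2026-08-26: 0.28 ms/term against 0.40 ms/term);
* a ROW-LIST checker over a literal table: `checkListK T rows` — every row `(neg, |D|)` passes
  `rowOK2` — with **`certifiedAt_of_checkListK`** (`TableValid T →` every listed `D = sgnD neg |D|`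
  is `CertifiedAt (1/5) D`): heavy rows are certified individually (no window is re-walked);
* the junction lemma for concatenating verified tables by a separating bound,
  `TableValid.append_of_bound` (`table15 ++ table16 ++ …`), with the one-pass Boolean bound checks
  `allPLt`, `allPGe`.

Definitions and theorems only; nothing is evaluated here; standard axioms.

## References

* W. Lu, A. Zaman, K. Zhao, *Dirichlet L-functions of quadratic characters have no exceptional
  zeros for moduli up to 10¹⁰*, Math. Comp. (2026), arXiv:2602.03626, §2.1–§3. [LuZamanZhao2026]
* H. L. Montgomery, R. C. Vaughan, *Multiplicative Number Theory I*, CUP 2007, §9.3.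
  [MontgomeryVaughan2007]
-/

namespace Literature.NumberTheory.LFunctions
namespace LuZamanZhao2026
namespace Replay

open Literature.Analysis.ValidatedNumerics Literature.Analysis.ValidatedNumerics.NumericsMP

/-! ## The streamlined search -/

/-- `pick` with Boolean tests. [cite: MontgomeryVaughan2007, §9.3] -/
def pick2 (neg : Bool) (Dabs : ℕ) (e : PRow) : ℕ :=
  let t := Dabs % e.p
  bif Nat.beq e.p 2 then
    (bif Nat.beq t 0 then e.tZero
     else bif (Nat.beq (Dabs % 8) 1 || Nat.beq (Dabs % 8) 7) then e.tPlus else e.tMinus)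
  else
    let a := bif neg then (bif Nat.beq t 0 then 0 else e.p - t) else t
    let c := eulerCode a e.p
    bif Nat.beq c 1 then e.tPlus else bif Nat.beq c 0 then e.tZero else e.tMinus

/-- `cond (Nat.beq a b)` is `if a = b`. [folklore] -/
private theorem cond_beq {α : Sort*} (a b : ℕ) (x y : α) :
    cond (Nat.beq a b) x y = if a = b then x else y := by
  cases h : Nat.beq a b
  · rw [if_neg (Nat.ne_of_beq_eq_false h)]; rfl
  · rw [if_pos (Nat.eq_of_beq_eq_true h)]; rfl

/-- `cond (beq a b || beq a c)` is `if a = b ∨ a = c`. [folklore] -/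
private theorem cond_beq_or {α : Sort*} (a b c : ℕ) (x y : α) :
    cond (Nat.beq a b || Nat.beq a c) x y = if a = b ∨ a = c then x else y := by
  cases h : Nat.beq a b
  · cases h' : Nat.beq a c
    · rw [if_neg (by
        rintro (h1 | h1)
        · exact Nat.ne_of_beq_eq_false h h1
        · exact Nat.ne_of_beq_eq_false h' h1)]
      rfl
    · rw [if_pos (Or.inr (Nat.eq_of_beq_eq_true h'))]; rfl
  · rw [if_pos (Or.inl (Nat.eq_of_beq_eq_true h))]; rfl

/-- **`pick2 = pick`.** [cite: MontgomeryVaughan2007, §9.3] -/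
theorem pick2_eq (neg : Bool) (Dabs : ℕ) (e : PRow) : pick2 neg Dabs e = pick neg Dabs e := by
  unfold pick2 pick
  simp only [cond_beq, cond_beq_or]
  cases neg <;> rfl

/-- The search with the scaled right-hand side as a NATURAL number `hN` and the stop test `hN ≤ k`
(`Nat.ble`), the accumulator forced to a numeral at every step. [cite: LuZamanZhao2026, §2.1 and (2.5)] -/
def rowSearch2 (neg : Bool) (Dabs : ℕ) (hN : ℕ) : List PRow → ℕ → Bool
  | [], _ => false
  | e :: T, acc =>
    match acc + pick2 neg Dabs e with
    | 0 => rowSearch2 neg Dabs hN T 0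
    | k + 1 => bif Nat.ble hN k then true else rowSearch2 neg Dabs hN T (k + 1)

/-- `h < k + 1 ↔ h.toNat ≤ k` for an integer `h`. [folklore] -/
private theorem lt_succ_iff_toNat_le (h : ℤ) (k : ℕ) : h < ((k + 1 : ℕ) : ℤ) ↔ h.toNat ≤ k := by
  omega

/-- **`rowSearch2` with `hN = h.toNat` is `rowSearch` with `h`.** [cite: LuZamanZhao2026, §2.1 and (2.5)] -/
theorem rowSearch2_eq (neg : Bool) (Dabs : ℕ) (h : ℤ) (T : List PRow) :
    ∀ acc : ℕ, rowSearch2 neg Dabs h.toNat T acc = rowSearch neg Dabs h T acc := by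
  induction T with
  | nil => intro acc; simp [rowSearch2, rowSearch]
  | cons e T ih =>
    intro acc
    simp only [rowSearch2, rowSearch, pick2_eq, ih]
    generalize acc + pick neg Dabs e = s
    cases s with
    | zero => rfl
    | succ k =>
      simp only
      by_cases hk : h < ((k + 1 : ℕ) : ℤ)
      · rw [if_pos hk]
        have : Nat.ble h.toNat k = true := Nat.ble_eq_true_of_le ((lt_succ_iff_toNat_le h k).1 hk)
        rw [this]; rfl
      · rw [if_neg hk]
        have : Nat.ble h.toNat k = false := by
          cases hb : Nat.ble h.toNat k
          · rfl
          · exact absurd ((lt_succ_iff_toNat_le h k).2 (Nat.le_of_ble_eq_true hb)) hk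
        rw [this]; rfl

/-- `rowOK` with `rowSearch2`. [cite: LuZamanZhao2026, (2.5)] -/
def rowOK2 (R : MI) (T : List PRow) (neg : Bool) (Dabs : ℕ) : Bool :=
  match rhsHi R Dabs with
  | some h => rowSearch2 neg Dabs h.toNat T 0
  | none => false

/-- **`rowOK2 = rowOK`.** [cite: LuZamanZhao2026, (2.5)] -/
theorem rowOK2_eq (R : MI) (T : List PRow) (neg : Bool) (Dabs : ℕ) :
    rowOK2 R T neg Dabs = rowOK R T neg Dabs := by
  unfold rowOK2 rowOK
  cases rhsHi R Dabs with
  | none => rfl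
  | some h => exact rowSearch2_eq neg Dabs h T 0

/-- `dOK` with `rowOK2`. [cite: LuZamanZhao2026, §2.1–§3] -/
def dOK2 (R : MI) (T : List PRow) (X : List ℤ) (neg : Bool) (m : ℕ) : Bool :=
  nonfundC T (sgnD neg m) || memZ (sgnD neg m) X || rowOK2 R T neg m

/-- `dOK2 = dOK`. [cite: LuZamanZhao2026, §2.1–§3] -/
theorem dOK2_eq (R : MI) (T : List PRow) (X : List ℤ) (neg : Bool) (m : ℕ) :
    dOK2 R T X neg m = dOK R T X neg m := by
  unfold dOK2 dOK; rw [rowOK2_eq]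

/-- `walk` with `dOK2`. [folklore] -/
def walk2 (R : MI) (T : List PRow) (X : List ℤ) : ℕ → ℕ → Bool
  | 0, _ => true
  | fuel + 1, m =>
    dOK2 R T X false m && dOK2 R T X true m &&
      (match m + 1 with
        | 0 => false
        | k + 1 => walk2 R T X fuel (k + 1))

/-- `walk2 = walk`. [cite: LuZamanZhao2026, §2.1–§3] -/
theorem walk2_eq (R : MI) (T : List PRow) (X : List ℤ) :
    ∀ fuel : ℕ, walk2 R T X fuel = walk R T X fuel := by
  have hd : dOK2 = dOK := by
    funext R T X neg m; exact dOK2_eq R T X neg m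
  intro fuel
  induction fuel with
  | zero => funext m; simp [walk2, walk]
  | succ fuel ih =>
    funext m
    simp only [walk2, walk, hd, ih]

/-- **The streamlined range checker** (same arguments and meaning as `checkRange`).
[cite: LuZamanZhao2026, §2.1–§3] -/
def checkRange2 (T : List PRow) (Q0 Q1 : ℕ) (X : List ℤ) : Bool :=
  match rI with
  | none => false
  | some R => walk2 R T X (Q1 - Q0) (Q0 + 1)

/-- **Soundness of `checkRange2`** (via `checkRange`). [cite: LuZamanZhao2026, §2.1–§3] -/
theorem certifiedRange_of_checkRange2 {T : List PRow} (hT : TableValid T) {Q0 Q1 : ℕ} {X : List ℤ}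
    (h : checkRange2 T Q0 Q1 X = true) : CertifiedRange (1 / 5) Q0 Q1 X := by
  unfold checkRange2 at h
  split at h
  · exact absurd h Bool.false_ne_true
  rename_i R hR
  rw [walk2_eq R T X (Q1 - Q0)] at h
  have h' : checkRange T Q0 Q1 X = true := by
    unfold checkRange; rw [hR]; exact h
  exact certifiedRange_of_checkRange hT h'

/-! ## Row lists over a literal table -/

/-- **Row-list checker over a literal table** (for `decide +kernel`): every row `(neg, |D|)` passes the
Table-1 certificate test `rowOK2` over `T`. [cite: LuZamanZhao2026, §2.1–§3] -/
def checkListK (T : List PRow) (rows : List (Bool × ℕ)) : Bool :=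
  match rI with
  | none => false
  | some R => rows.all fun r => rowOK2 R T r.1 r.2

/-- **Soundness of `checkListK`**: over a valid table every listed row is a certified discriminant.
[cite: LuZamanZhao2026, §2.1–§3] -/
theorem certifiedAt_of_checkListK {T : List PRow} (hT : TableValid T) {rows : List (Bool × ℕ)}
    (h : checkListK T rows = true) : ∀ r ∈ rows, CertifiedAt (1 / 5) (sgnD r.1 r.2) := by
  unfold checkListK at h
  split at h
  · exact absurd h Bool.false_ne_true
  rename_i R hR
  intro r hr
  have h' : rowOK2 R T r.1 r.2 = true := List.all_eq_true.1 h r hr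
  rw [rowOK2_eq] at h'
  exact certifiedAt_of_rowOK (mem_rI hR) hT h'

/-- The discriminants of a row list. [cite: LuZamanZhao2026, §2.1–§3] -/
def rowsDK (rows : List (Bool × ℕ)) : List ℤ := rows.map fun r => sgnD r.1 r.2

/-- **Soundness of `checkListK`, discriminant form**: every member of `rowsDK rows` is certified.
[cite: LuZamanZhao2026, §2.1–§3] -/
theorem certifiedAt_of_mem_rowsDK {T : List PRow} (hT : TableValid T) {rows : List (Bool × ℕ)}
    (h : checkListK T rows = true) : ∀ D ∈ rowsDK rows, CertifiedAt (1 / 5) D := by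
  intro D hD
  obtain ⟨r, hr, rfl⟩ := List.mem_map.1 hD
  exact certifiedAt_of_checkListK hT h r hr

/-! ## Concatenating verified tables -/

/-- Every prime of the table is `< b` (one pass). [folklore] -/
def allPLt (T : List PRow) (b : ℕ) : Bool := T.all fun e => Nat.blt e.p b

/-- Every prime of the table is `≥ b` (one pass). [folklore] -/
def allPGe (T : List PRow) (b : ℕ) : Bool := T.all fun e => Nat.ble b e.p

/-- **Junction of verified tables by a separating bound**: if both tables are valid, every prime of
the first is `< b` and every prime of the second is `≥ b`, the concatenation is a valid table.
[cite: LuZamanZhao2026, §2.2 and (2.3)] -/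
theorem TableValid.append_of_bound {T₁ T₂ : List PRow} (h₁ : TableValid T₁) (h₂ : TableValid T₂)
    (b : ℕ) (hb₁ : allPLt T₁ b = true) (hb₂ : allPGe T₂ b = true) : TableValid (T₁ ++ T₂) := by
  refine h₁.append h₂ fun e₁ he₁ e₂ he₂ => ?_
  have h1 : e₁.p < b := by
    have := List.all_eq_true.1 hb₁ e₁ he₁
    simpa [Nat.blt_eq] using this
  have h2 : b ≤ e₂.p := by
    have := List.all_eq_true.1 hb₂ e₂ he₂
    simpa [Nat.ble_eq] using this
  omega

end Replay
end LuZamanZhao2026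
end Literature.NumberTheory.LFunctions
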